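import Literature.Analysis.Fourier.HilbertTransformLineDerivPV
import Literature.Analysis.Fourier.HilbertTransformLineSplit
import Summits.NavierStokesRegularity.OSWSelfSimilar.SheetRFarFieldHilbert
import Summits.NavierStokesRegularity.OSWSelfSimilar.SheetRCayleySubstitution
import Mathlib.Analysis.SpecialFunctions.Arsinh
import Mathlib.Analysis.SpecialFunctions.Sqrt
import Mathlib.Analysis.SpecialFunctions.Trigonometric.Arctan
import Mathlib.MeasureTheory.Measure.Haar.NormedSpace
import HarnessLib

/-!
# SHEET-ℝ frame: closed forms of `H T₂` and `𝒰 T₂` for the far-field shape `T₂ = ξ(L² + ξ²)^{-3/2}`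

HONEST FRAMING (cell ns-blowup GROUP B / zone Z3, case Z3-SR-CERT; 1-D MODEL certificate frame; not Euler/NS).

The centre of the SHEET-ℝ certificate (cert-1 `SHEET-R-PRICE-impl1.md` §1/§4 T1; cert-2 F5(b)) is a finite sine series in the
Cayley angle plus a multiple of the far-field shape `T₂`, and the interval stage evaluates `H T₂` and the velocity
`𝒰T₂ = ∫₀^ξ H T₂` in CLOSED FORM. With `f(y) = (L² + y²)^{-1/2}` and the tree's closed form
`Hf(x) = (2/π)·arsinh(x/L)·(L² + x²)^{-1/2}` (`SheetRFarFieldHilbert.hilbertTransform_inv_sqrt_sq_add_sq`), the shape is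
`T₂ = −f′ = y·(L² + y²)^{-3/2}` (`∈ C^∞ ∩ L¹`, although `f ∉ L¹`), and this file PROVES, for `L > 0` and every `x`,

  `H T₂ (x) = (2/π)·[ x·arsinh(x/L)·(L² + x²)^{-3/2} − (L² + x²)^{-1} ]`     (`hilbertTransform_farFieldT2`),
  `𝒰 T₂ (x) = ∫₀ˣ H T₂ = −(2/π)·arsinh(x/L)·(L² + x²)^{-1/2}`              (`lineVelocity_farFieldT2`),

`(L² + x²)^{-3/2}` being written `((L² + x²)·√(L² + x²))⁻¹` throughout (no real powers). Mechanism: `H[f′] = (Hf)′` in the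
principal-value form `Literature.Analysis.Fourier.hasDerivAt_hilbertTransform_of_integrableOn` (base-point integrability of the
symmetric integrand — supplied by `SheetRFarFieldHilbert.integrable_invSqrt_symm_integrand` — instead of `f ∈ L¹`), the derivative
of the closed form of `Hf`, uniqueness of derivatives, and dilation covariance `L = 1 ↦ L`; the velocity is the fundamental theorem of
calculus (`𝒰T₂ = −Hf + Hf(0)`, `Hf(0) = 0`), with `lineHilbert T₂ = hilbertTransform T₂` because `T₂ ∈ C¹ ∩ L¹`. §5 is the
θ-dictionary at `ξ = L tan(θ/2)` used by the engines (PRICE T1, whose `T₂` is `L²`× ours `= sin(θ/2)cos²(θ/2)`):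
`L²·H T₂ = (1 + cos θ)π⁻¹[sin(θ/2)·arsinh(tan(θ/2)) − 1]`, `L²·𝒰T₂ = −(2L/π)·cos(θ/2)·arsinh(tan(θ/2))` (`arsinh ∘ tan = gd⁻¹`).
Falsifier anyone can run: `H T₂(0) = −2/(πL²)` (`hilbertTransform_farFieldT2_zero`). Pure calculus about explicit functions; no
definition, no named fact, nothing asserted about any profile. MODEL frame bookkeeping only.
-/

noncomputable section

namespace Summit.NavierStokesRegularity.OSWSelfSimilar
namespace SheetRFarFieldT2

open _root_.MeasureTheory _root_.Set _root_.Filter _root_.Real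
open scoped Real Topology
open Literature.Analysis.Fourier
open SheetRFarFieldHilbert (sqrt_one_add_sq_mul_self invSqrt_symm_integrand integrable_invSqrt_symm_integrand
  hilbertTransform_inv_sqrt_one_add_sq hilbertTransform_inv_sqrt_sq_add_sq)

/-! ### §1 Calculus of the inverse square root `f₁(y) = (1 + y²)^{-1/2}` -/

/-- `d/dy √(1 + y²) = y/√(1 + y²)`. [folklore] -/
theorem hasDerivAt_sqrt_one_add_sq (y : ℝ) : HasDerivAt (fun y : ℝ => √(1 + y ^ 2)) (y / √(1 + y ^ 2)) y := by
  have h1 : HasDerivAt (fun y : ℝ => 1 + y ^ 2) (2 * y) y := by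
    simpa using ((hasDerivAt_id y).pow 2).const_add 1
  have h2 := h1.sqrt (by positivity : (1 + y ^ 2) ≠ 0)
  refine h2.congr_deriv ?_
  rw [mul_div_mul_left _ _ (two_ne_zero)]

/-- `d/dy (1 + y²)^{-1/2} = −y·((1 + y²)√(1 + y²))⁻¹ = −T₂(y)` (`L = 1`). (The same three-line calculus fact is
`Summit.SmoothPoincare4.….hasDerivAt_invSqrtOneAddSq` in another summit's tree, which a Summits file cannot import.) [folklore] -/
theorem hasDerivAt_invSqrt (y : ℝ) :
    HasDerivAt (fun y : ℝ => (√(1 + y ^ 2))⁻¹) (-(y / ((1 + y ^ 2) * √(1 + y ^ 2)))) y := by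
  have hs0 : √(1 + y ^ 2) ≠ 0 := by positivity
  have h := (hasDerivAt_sqrt_one_add_sq y).fun_inv hs0
  refine h.congr_deriv ?_
  rw [Real.sq_sqrt (by positivity)]
  field_simp

/-- `deriv (1 + y²)^{-1/2} = −T₂` as functions (`L = 1`). [folklore] -/
theorem deriv_invSqrt :
    deriv (fun y : ℝ => (√(1 + y ^ 2))⁻¹) = fun y => -(y / ((1 + y ^ 2) * √(1 + y ^ 2))) :=
  funext fun y => (hasDerivAt_invSqrt y).deriv

/-- `T₂′(y) = (1 − 2y²)/((1 + y²)²√(1 + y²))` (`L = 1`). [folklore] -/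
theorem hasDerivAt_farFieldT2_one (y : ℝ) :
    HasDerivAt (fun y : ℝ => y / ((1 + y ^ 2) * √(1 + y ^ 2)))
      ((1 - 2 * y ^ 2) / ((1 + y ^ 2) ^ 2 * √(1 + y ^ 2))) y := by
  -- rewrite the shape as `y · ((1 + y²)^{-1/2})³`
  have hfun : (fun y : ℝ => y / ((1 + y ^ 2) * √(1 + y ^ 2))) = fun y => y * ((√(1 + y ^ 2))⁻¹) ^ 3 := by
    funext z
    set u := √(1 + z ^ 2) with hu
    have hu0 : u ≠ 0 := by rw [hu]; positivity
    have hu2 : 1 + z ^ 2 = u * u := (sqrt_one_add_sq_mul_self z).symm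
    rw [hu2]
    field_simp
  rw [hfun]
  have hprod := (hasDerivAt_id' y).fun_mul ((hasDerivAt_invSqrt y).fun_pow 3)
  refine hprod.congr_deriv ?_
  set u := √(1 + y ^ 2) with hu
  have hu0 : u ≠ 0 := by rw [hu]; positivity
  have hu2 : 1 + y ^ 2 = u * u := (sqrt_one_add_sq_mul_self y).symm
  rw [hu2]
  push_cast
  field_simp
  linear_combination (-1 : ℝ) * hu2

/-- The second derivative of `(1 + y²)^{-1/2}`: `−T₂′(y) = (2y² − 1)/((1 + y²)²√(1 + y²))`. [folklore] -/
theorem deriv_deriv_invSqrt (y : ℝ) :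
    deriv (deriv (fun y : ℝ => (√(1 + y ^ 2))⁻¹)) y = -((1 - 2 * y ^ 2) / ((1 + y ^ 2) ^ 2 * √(1 + y ^ 2))) := by
  rw [deriv_invSqrt]
  exact ((hasDerivAt_farFieldT2_one y).neg).deriv

/-- Bounded second derivative: `|((1 + y²)^{-1/2})″| ≤ 2`. [folklore] -/
theorem abs_deriv_deriv_invSqrt_le (y : ℝ) :
    |deriv (deriv (fun y : ℝ => (√(1 + y ^ 2))⁻¹)) y| ≤ 2 := by
  rw [deriv_deriv_invSqrt, abs_neg, abs_div, abs_of_pos (by positivity : (0:ℝ) < (1 + y ^ 2) ^ 2 * √(1 + y ^ 2)),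
    div_le_iff₀ (by positivity)]
  have hs1 : 1 ≤ √(1 + y ^ 2) := Literature.Analysis.SpecialFunctions.one_le_sqrt_one_add_sq y
  have h1 : |1 - 2 * y ^ 2| ≤ 1 + 2 * y ^ 2 := by
    rw [abs_le]; constructor <;> nlinarith [sq_nonneg y]
  have h2 : 1 + 2 * y ^ 2 ≤ 2 * ((1 + y ^ 2) ^ 2 * 1) := by nlinarith [sq_nonneg y]
  have h3 : (1 + y ^ 2) ^ 2 * 1 ≤ (1 + y ^ 2) ^ 2 * √(1 + y ^ 2) :=
    mul_le_mul_of_nonneg_left hs1 (by positivity)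
  linarith

/-- Decay of the first derivative: `|((1 + y²)^{-1/2})′| = |y|·((1 + y²)√(1 + y²))⁻¹ ≤ 1/(1 + y²)`. [folklore] -/
theorem abs_deriv_invSqrt_le (y : ℝ) :
    |deriv (fun y : ℝ => (√(1 + y ^ 2))⁻¹) y| ≤ 1 / (1 + y ^ 2) := by
  rw [deriv_invSqrt]
  rw [abs_neg, abs_div, abs_of_pos (by positivity : (0:ℝ) < (1 + y ^ 2) * √(1 + y ^ 2)),
    div_le_div_iff₀ (by positivity) (by positivity), one_mul]
  have hy : |y| ≤ √(1 + y ^ 2) := Real.abs_le_sqrt (by nlinarith)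
  calc |y| * (1 + y ^ 2) ≤ √(1 + y ^ 2) * (1 + y ^ 2) := by
        exact mul_le_mul_of_nonneg_right hy (by positivity)
    _ = (1 + y ^ 2) * √(1 + y ^ 2) := by ring

/-- `(1 + y²)^{-1/2}` is `C²` (indeed smooth). [folklore] -/
theorem contDiff_invSqrt : ContDiff ℝ 2 (fun y : ℝ => (√(1 + y ^ 2))⁻¹) := by
  have h1 : ContDiff ℝ 2 (fun y : ℝ => 1 + y ^ 2) := by fun_prop
  have h2 : ContDiff ℝ 2 (fun y : ℝ => √(1 + y ^ 2)) := h1.sqrt fun x => by positivity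
  exact h2.inv fun x => by positivity

/-! ### §2 `H T₂` at `L = 1` -/

/-- The symmetric integrand of `(1 + y²)^{-1/2}` is integrable on `(0, ∞)` at every base point (it is the tree's explicit
`4x/(√A√B(√A+√B))` there). [folklore] -/
theorem integrableOn_invSqrt_symmIntegrand (x : ℝ) :
    IntegrableOn (fun t : ℝ => ((√(1 + (x - t) ^ 2))⁻¹ - (√(1 + (x + t) ^ 2))⁻¹) / t) (Ioi 0) := by
  refine ((integrable_invSqrt_symm_integrand x).integrableOn (s := Ioi 0)).congr_fun ?_ measurableSet_Ioi
  intro t ht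
  exact (invSqrt_symm_integrand x (ne_of_gt ht)).symm

/-- `H[(1 + y²)^{-1/2}]` is differentiable with derivative `H[((1 + y²)^{-1/2})′]` (principal-value derivative rule). [folklore] -/
theorem hasDerivAt_hilbertTransform_invSqrt (x : ℝ) :
    HasDerivAt (hilbertTransform fun y : ℝ => (√(1 + y ^ 2))⁻¹)
      (hilbertTransform (deriv fun y : ℝ => (√(1 + y ^ 2))⁻¹) x) x :=
  hasDerivAt_hilbertTransform_of_integrableOn (M := 2) (C := 1) contDiff_invSqrt abs_deriv_deriv_invSqrt_le
    abs_deriv_invSqrt_le (integrableOn_invSqrt_symmIntegrand x)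

/-- The derivative of the closed form: `d/dx [(2/π)·arsinh x·(1 + x²)^{-1/2}] = (2/π)·[(1 + x²)⁻¹ − x·arsinh x·((1 + x²)√(1 + x²))⁻¹]`.
[folklore] -/
theorem hasDerivAt_arsinh_div_sqrt (x : ℝ) :
    HasDerivAt (fun x : ℝ => 2 / π * Real.arsinh x / √(1 + x ^ 2))
      (2 / π * ((1 + x ^ 2)⁻¹ - x * Real.arsinh x / ((1 + x ^ 2) * √(1 + x ^ 2)))) x := by
  have hs0 : √(1 + x ^ 2) ≠ 0 := by positivity
  have h := ((Real.hasDerivAt_arsinh x).const_mul (2 / π)).fun_div (hasDerivAt_sqrt_one_add_sq x) hs0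
  refine h.congr_deriv ?_
  set u := √(1 + x ^ 2) with hu
  have hu2 : 1 + x ^ 2 = u * u := (sqrt_one_add_sq_mul_self x).symm
  rw [hu2]
  field_simp

/-- `H[((1 + y²)^{-1/2})′](x) = (2/π)·[(1 + x²)⁻¹ − x·arsinh x·((1 + x²)√(1 + x²))⁻¹]`. [folklore] -/
theorem hilbertTransform_deriv_invSqrt (x : ℝ) :
    hilbertTransform (deriv fun y : ℝ => (√(1 + y ^ 2))⁻¹) x =
      2 / π * ((1 + x ^ 2)⁻¹ - x * Real.arsinh x / ((1 + x ^ 2) * √(1 + x ^ 2))) := by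
  have hH : (hilbertTransform fun y : ℝ => (√(1 + y ^ 2))⁻¹) = fun x => 2 / π * Real.arsinh x / √(1 + x ^ 2) :=
    funext hilbertTransform_inv_sqrt_one_add_sq
  have h1 := hasDerivAt_hilbertTransform_invSqrt x
  rw [hH] at h1
  exact h1.unique (hasDerivAt_arsinh_div_sqrt x)

/-- **`H T₂` at `L = 1`**: `H[y·((1 + y²)√(1 + y²))⁻¹](x) = (2/π)·[x·arsinh x·((1 + x²)√(1 + x²))⁻¹ − (1 + x²)⁻¹]`. [folklore] -/
theorem hilbertTransform_farFieldT2_one (x : ℝ) :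
    hilbertTransform (fun y : ℝ => y / ((1 + y ^ 2) * √(1 + y ^ 2))) x =
      2 / π * (x * Real.arsinh x / ((1 + x ^ 2) * √(1 + x ^ 2)) - (1 + x ^ 2)⁻¹) := by
  have hfun : (fun y : ℝ => y / ((1 + y ^ 2) * √(1 + y ^ 2))) =
      fun y => -(deriv (fun y : ℝ => (√(1 + y ^ 2))⁻¹) y) := by
    rw [deriv_invSqrt]; funext y; ring
  rw [hfun, hilbertTransform_neg, hilbertTransform_deriv_invSqrt]
  ring

/-! ### §3 `H T₂` for every `L > 0` (dilation covariance) -/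

/-- `√(L² + y²) = L·√(1 + (y/L)²)` (`L > 0`). [folklore] -/
theorem sqrt_sq_add_sq_eq {L : ℝ} (hL : 0 < L) (y : ℝ) : √(L ^ 2 + y ^ 2) = L * √(1 + (y / L) ^ 2) := by
  have hL0 : L ≠ 0 := hL.ne'
  have h : L ^ 2 + y ^ 2 = L ^ 2 * (1 + (y / L) ^ 2) := by field_simp
  rw [h, Real.sqrt_mul (by positivity), Real.sqrt_sq hL.le]

/-- Scaling of the shape: `y·((L² + y²)√(L² + y²))⁻¹ = L⁻²·[s·((1 + s²)√(1 + s²))⁻¹]_{s = y/L}`. [folklore] -/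
theorem farFieldT2_scale {L : ℝ} (hL : 0 < L) (y : ℝ) :
    y / ((L ^ 2 + y ^ 2) * √(L ^ 2 + y ^ 2)) =
      (L ^ 2)⁻¹ * ((y / L) / ((1 + (y / L) ^ 2) * √(1 + (y / L) ^ 2))) := by
  have hL0 : L ≠ 0 := hL.ne'
  have h1 : L ^ 2 + y ^ 2 = L ^ 2 * (1 + (y / L) ^ 2) := by field_simp
  rw [sqrt_sq_add_sq_eq hL, h1]
  have : √(1 + (y / L) ^ 2) ≠ 0 := by positivity
  field_simp

/-- **`H T₂`**: for `L > 0`, `H[y·((L² + y²)√(L² + y²))⁻¹](x) = (2/π)·[x·arsinh(x/L)·((L² + x²)√(L² + x²))⁻¹ − (L² + x²)⁻¹]`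
— the closed form of the Hilbert transform of the far-field shape `T₂ = ξ(L² + ξ²)^{-3/2}` of the SHEET-ℝ certificate frame
(PRICE-impl1 §4 T1). [folklore] -/
theorem hilbertTransform_farFieldT2 {L : ℝ} (hL : 0 < L) (x : ℝ) :
    hilbertTransform (fun y : ℝ => y / ((L ^ 2 + y ^ 2) * √(L ^ 2 + y ^ 2))) x =
      2 / π * (x * Real.arsinh (x / L) / ((L ^ 2 + x ^ 2) * √(L ^ 2 + x ^ 2)) - (L ^ 2 + x ^ 2)⁻¹) := by
  have hL0 : L ≠ 0 := hL.ne'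
  have hfun : (fun y : ℝ => y / ((L ^ 2 + y ^ 2) * √(L ^ 2 + y ^ 2))) =
      fun y => (L ^ 2)⁻¹ * ((fun s : ℝ => s / ((1 + s ^ 2) * √(1 + s ^ 2))) (y / L)) :=
    funext fun y => farFieldT2_scale hL y
  rw [hfun, hilbertTransform_const_mul,
    hilbertTransform_comp_div (fun s : ℝ => s / ((1 + s ^ 2) * √(1 + s ^ 2))) hL x,
    hilbertTransform_farFieldT2_one]
  have h1 : L ^ 2 + x ^ 2 = L ^ 2 * (1 + (x / L) ^ 2) := by field_simp
  rw [sqrt_sq_add_sq_eq hL, h1]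
  have : √(1 + (x / L) ^ 2) ≠ 0 := by positivity
  field_simp

/-- Falsifier value at the origin: `H T₂(0) = −2/(πL²)` (`= −(2/π)∫₀^∞ (L² + t²)^{-3/2} dt`). [folklore] -/
theorem hilbertTransform_farFieldT2_zero {L : ℝ} (hL : 0 < L) :
    hilbertTransform (fun y : ℝ => y / ((L ^ 2 + y ^ 2) * √(L ^ 2 + y ^ 2))) 0 = -(2 / (π * L ^ 2)) := by
  have hL0 : L ≠ 0 := hL.ne'
  rw [hilbertTransform_farFieldT2 hL]
  simp only [zero_div, Real.arsinh_zero, mul_zero, zero_sub]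
  have : L ^ 2 + (0:ℝ) ^ 2 = L ^ 2 := by ring
  rw [this]
  field_simp

/-! ### §4 `T₂ ∈ C¹ ∩ L¹`; `lineHilbert T₂`; the velocity `𝒰T₂ = ∫₀ˣ H T₂` -/

/-- `T₂` is smooth. [folklore] -/
theorem contDiff_farFieldT2 {L : ℝ} (hL : 0 < L) {n : WithTop ℕ∞} :
    ContDiff ℝ n (fun y : ℝ => y / ((L ^ 2 + y ^ 2) * √(L ^ 2 + y ^ 2))) := by
  have h1 : ContDiff ℝ n (fun y : ℝ => L ^ 2 + y ^ 2) := by fun_prop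
  have h2 : ContDiff ℝ n (fun y : ℝ => √(L ^ 2 + y ^ 2)) := h1.sqrt fun x => by positivity
  exact contDiff_id.div (h1.mul h2) fun x => by positivity

/-- `|T₂(y)| ≤ (L² + y²)⁻¹` (`|y| ≤ √(L² + y²)`). [folklore] -/
theorem abs_farFieldT2_le {L : ℝ} (hL : 0 < L) (y : ℝ) :
    |y / ((L ^ 2 + y ^ 2) * √(L ^ 2 + y ^ 2))| ≤ (L ^ 2 + y ^ 2)⁻¹ := by
  have hw : 0 < L ^ 2 + y ^ 2 := by positivity
  have hs : 0 < √(L ^ 2 + y ^ 2) := Real.sqrt_pos.2 hw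
  rw [abs_div, abs_of_pos (by positivity : (0:ℝ) < (L ^ 2 + y ^ 2) * √(L ^ 2 + y ^ 2)),
    div_le_iff₀ (by positivity)]
  have hy : |y| ≤ √(L ^ 2 + y ^ 2) := Real.abs_le_sqrt (by nlinarith [sq_nonneg L])
  calc |y| ≤ √(L ^ 2 + y ^ 2) := hy
    _ = (L ^ 2 + y ^ 2)⁻¹ * ((L ^ 2 + y ^ 2) * √(L ^ 2 + y ^ 2)) := by field_simp

/-- `T₂ ∈ L¹(ℝ)`. [folklore] -/
theorem integrable_farFieldT2 {L : ℝ} (hL : 0 < L) :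
    Integrable (fun y : ℝ => y / ((L ^ 2 + y ^ 2) * √(L ^ 2 + y ^ 2))) := by
  have hL0 : L ≠ 0 := hL.ne'
  have hdom : Integrable fun y : ℝ => (L ^ 2)⁻¹ * (1 + (y / L) ^ 2)⁻¹ :=
    (integrable_inv_one_add_sq.comp_div hL0).const_mul _
  refine hdom.mono' (contDiff_farFieldT2 hL (n := 1)).continuous.aestronglyMeasurable
    (Eventually.of_forall fun y => ?_)
  rw [Real.norm_eq_abs]
  refine (abs_farFieldT2_le hL y).trans (le_of_eq ?_)
  field_simp

/-- On `T₂ ∈ C¹ ∩ L¹` the split-form operator `lineHilbert` of the gCLM files agrees with `hilbertTransform`: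
**`lineHilbert T₂ (x) = (2/π)·[x·arsinh(x/L)·((L² + x²)√(L² + x²))⁻¹ − (L² + x²)⁻¹]`**. [folklore] -/
theorem lineHilbert_farFieldT2 {L : ℝ} (hL : 0 < L) (x : ℝ) :
    Literature.Analysis.FluidPDE.lineHilbert (fun y : ℝ => y / ((L ^ 2 + y ^ 2) * √(L ^ 2 + y ^ 2))) x =
      2 / π * (x * Real.arsinh (x / L) / ((L ^ 2 + x ^ 2) * √(L ^ 2 + x ^ 2)) - (L ^ 2 + x ^ 2)⁻¹) := by
  rw [lineHilbert_eq_hilbertTransform_of_contDiff (contDiff_farFieldT2 hL) (integrable_farFieldT2 hL)]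
  exact hilbertTransform_farFieldT2 hL x

/-- The derivative of the height-`L` closed form of `H[(L² + y²)^{-1/2}]`:
`d/dx [(2/π)·arsinh(x/L)·(L² + x²)^{-1/2}] = −H T₂(x)` (`L > 0`). [folklore] -/
theorem hasDerivAt_arsinh_div_sqrt_sq_add_sq {L : ℝ} (hL : 0 < L) (x : ℝ) :
    HasDerivAt (fun x : ℝ => 2 / π * Real.arsinh (x / L) / √(L ^ 2 + x ^ 2))
      (-(2 / π * (x * Real.arsinh (x / L) / ((L ^ 2 + x ^ 2) * √(L ^ 2 + x ^ 2)) - (L ^ 2 + x ^ 2)⁻¹))) x := by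
  have hL0 : L ≠ 0 := hL.ne'
  have hw : 0 < L ^ 2 + x ^ 2 := by positivity
  have hs0 : √(L ^ 2 + x ^ 2) ≠ 0 := (Real.sqrt_pos.2 hw).ne'
  -- `d/dx arsinh(x/L) = (√(1 + (x/L)²))⁻¹·L⁻¹`
  have ha : HasDerivAt (fun x : ℝ => Real.arsinh (x / L)) ((√(1 + (x / L) ^ 2))⁻¹ * (1 / L)) x := by
    have := (Real.hasDerivAt_arsinh (x / L)).comp x ((hasDerivAt_id x).div_const L)
    simpa [Function.comp_def] using this
  -- `d/dx √(L² + x²) = x/√(L² + x²)`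
  have hsq : HasDerivAt (fun x : ℝ => √(L ^ 2 + x ^ 2)) (x / √(L ^ 2 + x ^ 2)) x := by
    have h1 : HasDerivAt (fun x : ℝ => L ^ 2 + x ^ 2) (2 * x) x := by
      simpa using ((hasDerivAt_id x).pow 2).const_add (L ^ 2)
    refine (h1.sqrt hw.ne').congr_deriv ?_
    rw [mul_div_mul_left _ _ (two_ne_zero)]
  have h := (ha.const_mul (2 / π)).fun_div hsq hs0
  refine h.congr_deriv ?_
  rw [sqrt_sq_add_sq_eq hL x]
  set u := √(1 + (x / L) ^ 2) with hu
  have hu0 : u ≠ 0 := by rw [hu]; positivity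
  have hu2 : L ^ 2 + x ^ 2 = L ^ 2 * (u * u) := by
    rw [hu, sqrt_one_add_sq_mul_self]; field_simp
  rw [hu2]
  field_simp
  ring

/-- The closed form of `H T₂` is continuous. [folklore] -/
theorem continuous_hilbertTransform_farFieldT2 {L : ℝ} (hL : 0 < L) :
    Continuous fun x : ℝ =>
      2 / π * (x * Real.arsinh (x / L) / ((L ^ 2 + x ^ 2) * √(L ^ 2 + x ^ 2)) - (L ^ 2 + x ^ 2)⁻¹) := by
  have hL0 : L ≠ 0 := hL.ne'
  have hden : ∀ x : ℝ, (L ^ 2 + x ^ 2) * √(L ^ 2 + x ^ 2) ≠ 0 := fun x => by positivity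
  have hden' : ∀ x : ℝ, L ^ 2 + x ^ 2 ≠ 0 := fun x => by positivity
  have hnum : Continuous fun x : ℝ => x * Real.arsinh (x / L) :=
    continuous_id.mul (Real.continuous_arsinh.comp (continuous_id.div_const L))
  have hd : Continuous fun x : ℝ => (L ^ 2 + x ^ 2) * √(L ^ 2 + x ^ 2) := by fun_prop
  have hw : Continuous fun x : ℝ => L ^ 2 + x ^ 2 := by fun_prop
  exact continuous_const.mul ((hnum.div hd hden).sub (hw.inv₀ hden'))

/-- **`∫₀ˣ H T₂ = −(2/π)·arsinh(x/L)·(L² + x²)^{-1/2}`** (`= −H[(L² + y²)^{-1/2}](x)`; fundamental theorem of calculus with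
`hasDerivAt_arsinh_div_sqrt_sq_add_sq`, the closed form vanishing at `0`). [folklore] -/
theorem integral_hilbertTransform_farFieldT2 {L : ℝ} (hL : 0 < L) (x : ℝ) :
    ∫ y in (0:ℝ)..x, hilbertTransform (fun y : ℝ => y / ((L ^ 2 + y ^ 2) * √(L ^ 2 + y ^ 2))) y =
      -(2 / π * Real.arsinh (x / L) / √(L ^ 2 + x ^ 2)) := by
  have hH : (hilbertTransform fun y : ℝ => y / ((L ^ 2 + y ^ 2) * √(L ^ 2 + y ^ 2))) =
      fun x => 2 / π * (x * Real.arsinh (x / L) / ((L ^ 2 + x ^ 2) * √(L ^ 2 + x ^ 2)) - (L ^ 2 + x ^ 2)⁻¹) :=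
    funext (hilbertTransform_farFieldT2 hL)
  rw [hH, intervalIntegral.integral_eq_sub_of_hasDerivAt
    (f := fun x : ℝ => -(2 / π * Real.arsinh (x / L) / √(L ^ 2 + x ^ 2)))
    (fun y _ => ((hasDerivAt_arsinh_div_sqrt_sq_add_sq hL y).neg).congr_deriv (neg_neg _))
    ((continuous_hilbertTransform_farFieldT2 hL).intervalIntegrable 0 x)]
  simp [Real.arsinh_zero]

/-- **`𝒰T₂`**: for the gCLM velocity `lineVelocity f = ∫₀ˣ lineHilbert f`,
`𝒰T₂(x) = −(2/π)·arsinh(x/L)·(L² + x²)^{-1/2}` (`L > 0`) — the closed form of the velocity of the far-field shape of the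
SHEET-ℝ certificate frame (PRICE-impl1 §4 T1). [folklore] -/
theorem lineVelocity_farFieldT2 {L : ℝ} (hL : 0 < L) (x : ℝ) :
    Literature.Analysis.FluidPDE.lineVelocity (fun y : ℝ => y / ((L ^ 2 + y ^ 2) * √(L ^ 2 + y ^ 2))) x =
      -(2 / π * Real.arsinh (x / L) / √(L ^ 2 + x ^ 2)) := by
  rw [Literature.Analysis.FluidPDE.lineVelocity_def,
    lineHilbert_eq_hilbertTransform_of_contDiff (contDiff_farFieldT2 hL) (integrable_farFieldT2 hL)]
  exact integral_hilbertTransform_farFieldT2 hL x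

/-! ### §5 The θ-dictionary at `ξ = L tan(θ/2)` (`θ/2 = arctan(ξ/L)`; `arsinh(ξ/L) = arsinh(tan(θ/2)) = gd⁻¹(θ/2)`) -/

/-- `√(1 + (ξ/L)²) = √(L² + ξ²)/L` (`L > 0`). [folklore] -/
theorem sqrt_one_add_div_sq {L : ℝ} (hL : 0 < L) (ξ : ℝ) : √(1 + (ξ / L) ^ 2) = √(L ^ 2 + ξ ^ 2) / L := by
  rw [sqrt_sq_add_sq_eq hL ξ, mul_div_cancel_left₀ _ hL.ne']

/-- PRICE-impl1's normalisation of the shape: **`L²·T₂(ξ) = sin(θ/2)·cos²(θ/2)`**, `θ/2 = arctan(ξ/L)`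
(a half-angle trig polynomial). [folklore] -/
theorem farFieldT2_cayley {L : ℝ} (hL : 0 < L) (ξ : ℝ) :
    L ^ 2 * (ξ / ((L ^ 2 + ξ ^ 2) * √(L ^ 2 + ξ ^ 2))) =
      Real.sin (Real.arctan (ξ / L)) * Real.cos (Real.arctan (ξ / L)) ^ 2 := by
  have hL0 : L ≠ 0 := hL.ne'
  rw [Real.sin_arctan, Real.cos_arctan, sqrt_one_add_div_sq hL]
  set u := √(L ^ 2 + ξ ^ 2) with hu
  have hu0 : u ≠ 0 := by rw [hu]; positivity
  have hu2 : L ^ 2 + ξ ^ 2 = u * u := (Real.mul_self_sqrt (by positivity)).symm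
  rw [hu2]
  field_simp

/-- **`L²·H T₂ = (1 + cos θ)·π⁻¹·[sin(θ/2)·arsinh(tan(θ/2)) − 1]`** at `ξ = L tan(θ/2)`, i.e. with `θ = 2·arctan(ξ/L)`:
PRICE-impl1 §4 T1's `H T₂ = (1 + cos θ)π⁻¹[sin(θ/2)gd⁻¹(θ/2) − 1]` (their `T₂ = L²`× ours; `gd⁻¹(θ/2) = arsinh(tan(θ/2)) = arsinh(ξ/L)`).
[folklore] -/
theorem hilbertTransform_farFieldT2_cayley {L : ℝ} (hL : 0 < L) (ξ : ℝ) :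
    L ^ 2 * hilbertTransform (fun y : ℝ => y / ((L ^ 2 + y ^ 2) * √(L ^ 2 + y ^ 2))) ξ =
      (1 + Real.cos (2 * Real.arctan (ξ / L))) / π *
        (Real.sin (Real.arctan (ξ / L)) * Real.arsinh (ξ / L) - 1) := by
  have hL0 : L ≠ 0 := hL.ne'
  rw [hilbertTransform_farFieldT2 hL, SheetRCayleySubstitution.one_add_cos_cayleyAngle hL0, Real.sin_arctan,
    sqrt_one_add_div_sq hL]
  set u := √(L ^ 2 + ξ ^ 2) with hu
  have hu0 : u ≠ 0 := by rw [hu]; positivity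
  have hu2 : L ^ 2 + ξ ^ 2 = u * u := (Real.mul_self_sqrt (by positivity)).symm
  rw [hu2]
  field_simp

/-- The same identity with the angle's tangent made explicit: `arsinh(ξ/L) = arsinh(tan(arctan(ξ/L)))`. [folklore] -/
theorem arsinh_div_eq_arsinh_tan_arctan (L ξ : ℝ) :
    Real.arsinh (ξ / L) = Real.arsinh (Real.tan (Real.arctan (ξ / L))) := by
  rw [Real.tan_arctan]

/-- **`L²·𝒰T₂ = −(2L/π)·cos(θ/2)·arsinh(tan(θ/2))`** at `ξ = L tan(θ/2)` (`θ/2 = arctan(ξ/L)`): PRICE-impl1 §4 T1's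
`𝒰T₂ = −(4L/π)Σ_{j≥1}(−1)^{j−1} sin jθ/(4j² − 1)` summed in closed form (`cos(θ/2)·gd⁻¹(θ/2) = 2Σ(−1)^{j−1}sin jθ/(4j²−1)`).
[folklore] -/
theorem lineVelocity_farFieldT2_cayley {L : ℝ} (hL : 0 < L) (ξ : ℝ) :
    L ^ 2 * Literature.Analysis.FluidPDE.lineVelocity (fun y : ℝ => y / ((L ^ 2 + y ^ 2) * √(L ^ 2 + y ^ 2))) ξ =
      -(2 * L / π) * Real.cos (Real.arctan (ξ / L)) * Real.arsinh (ξ / L) := by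
  have hL0 : L ≠ 0 := hL.ne'
  rw [lineVelocity_farFieldT2 hL, Real.cos_arctan, sqrt_one_add_div_sq hL]
  have hu0 : √(L ^ 2 + ξ ^ 2) ≠ 0 := by positivity
  field_simp

end SheetRFarFieldT2
end Summit.NavierStokesRegularity.OSWSelfSimilar
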